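import Mathlib
import HarnessLib
import Summits.NavierStokesRegularity.NavierStokesRegularity.Theorems.UnthreadedRigidityDoorUnthreadedRigidityVirialHornBracketAll
import Summits.NavierStokesRegularity.NavierStokesRegularity.Theorems.UnthreadedRigidityDoorUnthreadedRigidityVirialHornDegreeTwo
import Summits.NavierStokesRegularity.NavierStokesRegularity.Theorems.UnthreadedRigidityDoorUnthreadedRigidityPressureHornSupports

/-!
# Route `UnthreadedRigidityDoor`, item `UnthreadedRigidity` (W2, stmt-NavierStokesRegularity-27585) — LINE g10-1 «PRESSURE HORN»:
# BRIDGE W BY NAME `windowWedgeAnalytic_holds` and the ISOTYPIC `l = 2` WINDOW RUNG `isotypicWindowRigidity_holds`, UNCONDITIONAL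
# (the isotypic degree-two dictionary: a radial FAMILY OF FORMS is a degree-two isotypic family over a fixed basis of `V₂`)

Prover file (W2 Lean hand ns-crc-p2 g11, by lineage; `--supports stmt-NavierStokesRegularity-27585`, helper; 0 kit).  After ns-crc-p1 g9's
bookkeeping (`…HornPressureRungs`, p723842) the isotypic `l = 2` window rung of K2-p2 g13's PRESSURE HORN line waited on its BRIDGE W
`PressureHorn.WindowWedgeAnalytic` ALONE («bracket injectivity in degree 2, KEY-NS #210, crc-p2»).  ns-crc-p2 g10 landed the degree-general form
`VirialHorn.windowWedgeAnalyticL_holds : WindowWedgeAnalyticL` (p729108) and the window rung `ThreadingJets.isotypicWindowRigidity_all` in every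
degree, but in the VIRIAL HORN currency (coefficient profiles against a FIXED linearly independent family of solid harmonics).  This file is the
dictionary between the two currencies at `l = 2` and the two by-name closures it yields:

* `basisV2` / `coordV2` — the basis `E₀ = diag(1,0,−1)`, `E₁ = diag(0,1,−1)`, `E₂ = e₀⊗e₁+e₁⊗e₀`, `E₃ = e₀⊗e₂+e₂⊗e₀`, `E₄ = e₁⊗e₂+e₂⊗e₁` of the
  trace-free symmetric forms and the coordinates `(M₀₀, M₁₁, M₀₁, M₀₂, M₁₂)`; `eq_sum_coordV2` (`M = Σ coordₘ(M)·Eₘ` for `M ∈ V₂`),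
  `quadY_eq_sum_coord`, `linearIndependent_quadY_basisV2` (the five quadratics `Y_{Eₘ}` are linearly independent functions; K2-p2 g13's
  `PressureHorn.quadY_smul` / `wedgeDet_zero_left` / `wedgeDet_smul_smul` of `…PressureHornSupports` are reused by name);
* `isoShell_eq_isoShellL` — `isoShell Q x₀ = isoShellL 5 (coordinates of Q) (Y_{E·}) x₀`; `isoAdmissibleL_coord` — `IsoAdmissible Q ⇒
  IsoAdmissibleL 2 5` (entry profiles are horn-admissible, `virialAdmissible_two_of_hornAdmissible`, `isSolidHarmonic_quadY`);
* `radDeriv_eq_sum` — for `r > 0` the entrywise radial derivative is `Σ (coordₘ)′(r)·Eₘ` (symmetry and trace persist under `d/dr`);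
  `wedgeVanishes_of_coord` — vanishing radial Wronskians of the coordinates ⇒ `Q′(r) ∥ Q(r)` (or `Q(r) = 0`) ⇒ `det[y, Q(r)y, Q′(r)y] = 0`;
  `analyticOnNhd_entry_of_coord` — analytic coordinates ⇒ analytic entries on `(0,∞)`;
* ★★ `windowWedgeAnalytic_holds : PressureHorn.WindowWedgeAnalytic` — BRIDGE W of LINE g10-1 is a THEOREM (from `windowWedgeAnalyticL_holds` at
  `l = 2`, `n = 5`);
* ★★ `isotypicWindowRigidity_holds : PressureHorn.IsotypicWindowRigidity` — the isotypic `l = 2` WINDOW RUNG of LINE g10-1 (the crux 27585 with its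
  hypotheses VERBATIM, restricted to windows all of whose slices are admissible `l = 2`-isotypic poloidal data about `x₀`, the radial family of forms
  depending on `t` arbitrarily) holds UNCONDITIONALLY (from `ThreadingJets.isotypicWindowRigidity_all 2 5`).  Equivalently
  `HornPressure.isotypicWindowRigidity_of_wedge windowWedgeAnalytic_holds` (p723842; that road passes through the theses cone and is not imported here).

HONEST LABEL: linear algebra of `3 × 3` trace-free symmetric forms plus composition of landed files; the two closures are statements about
HYPOTHETICAL bounded mild windows all of whose slices are SPECIAL (isotypic `l = 2`) data — a rung and a bridge of one line on the wall item, two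
levels below the door; `UnthreadedRigidity` ⟨27585⟩, W2 and NS regularity remain OPEN; no summit statement is proved here.  [folklore]
-/

-- the summit and its single sub-problem share the name (CONVENTIONS §1), as in every Theorems file
set_option linter.dupNamespace false

noncomputable section

namespace Summit.NavierStokesRegularity.NavierStokesRegularity.Theorems.UnthreadedRigidity.HornPressure

open scoped Topology
open Filter Set
open Summit.NavierStokesRegularity.NavierStokesRegularity.Theorems.UnthreadedRigidity.ProfileHorn (E3 IsQuadForm quadY HornAdmissible)
open Summit.NavierStokesRegularity.NavierStokesRegularity.Theorems.UnthreadedRigidity.VirialHorn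
  (IsSolidHarmonic VirialAdmissible isoShellL IsoAdmissibleL WedgeVanishesL WindowWedgeAnalyticL IsotypicWindowRigidityL
   windowWedgeAnalyticL_holds isSolidHarmonic_quadY virialAdmissible_two_of_hornAdmissible)
open Summit.NavierStokesRegularity.NavierStokesRegularity.Theorems.UnthreadedRigidity.ThreadingJets (isotypicWindowRigidity_all)
open Summit.NavierStokesRegularity.NavierStokesRegularity.Theorems.UnthreadedRigidity.PressureHorn
  (isoShell radDeriv IsoAdmissible wedgeDet WedgeVanishes WindowWedgeAnalytic IsotypicWindowRigidity
   quadY_smul wedgeDet_zero_left wedgeDet_smul_smul)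

/-! ## The basis of `V₂` and the coordinates -/

/-- row index of the `m`-th coordinate entry: `(0,1,0,0,1)`. -/
def cI : Fin 5 → Fin 3 := ![0, 1, 0, 0, 1]

/-- column index of the `m`-th coordinate entry: `(0,1,1,2,2)`. -/
def cJ : Fin 5 → Fin 3 := ![0, 1, 1, 2, 2]

/-- the basis `E₀ = diag(1,0,−1)`, `E₁ = diag(0,1,−1)`, `E₂, E₃, E₄` = the symmetrised off-diagonal units of the trace-free symmetric `3 × 3` forms. -/
def basisV2 : Fin 5 → Matrix (Fin 3) (Fin 3) ℝ :=
  ![!![1, 0, 0; 0, 0, 0; 0, 0, -1], !![0, 0, 0; 0, 1, 0; 0, 0, -1], !![0, 1, 0; 1, 0, 0; 0, 0, 0],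
    !![0, 0, 1; 0, 0, 0; 1, 0, 0], !![0, 0, 0; 0, 0, 1; 0, 1, 0]]

/-- the coordinates of a form in the basis `basisV2`: the entries `(M₀₀, M₁₁, M₀₁, M₀₂, M₁₂)`. -/
def coordV2 (M : Matrix (Fin 3) (Fin 3) ℝ) (m : Fin 5) : ℝ := M (cI m) (cJ m)

/-- each basis form is symmetric and trace free. -/
theorem isQuadForm_basisV2 (m : Fin 5) : IsQuadForm (basisV2 m) := by
  fin_cases m
  all_goals
    refine ⟨Matrix.IsSymm.ext fun i j => ?_, ?_⟩
    · fin_cases i <;> fin_cases j <;> simp [basisV2]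
    · simp [basisV2, Matrix.trace_fin_three]

/-- a trace-free symmetric form is the combination of the basis forms with its coordinates. -/
theorem eq_sum_coordV2 {M : Matrix (Fin 3) (Fin 3) ℝ} (hM : IsQuadForm M) : M = ∑ m : Fin 5, coordV2 M m • basisV2 m := by
  obtain ⟨hs, ht⟩ := hM
  have h10 : M 1 0 = M 0 1 := hs.apply 0 1
  have h20 : M 2 0 = M 0 2 := hs.apply 0 2
  have h21 : M 2 1 = M 1 2 := hs.apply 1 2
  have h22 : M 2 2 = -M 0 0 + -M 1 1 := by
    rw [Matrix.trace_fin_three] at ht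
    linarith
  ext i j
  fin_cases i <;> fin_cases j <;>
    simp [coordV2, cI, cJ, basisV2, Fin.sum_univ_five, Matrix.sum_apply, Matrix.smul_apply, h10, h20, h21, h22]

/-! ## `Y_Q` is linear in `Q` -/

/-- additivity of `Q ↦ Y_Q(y)`. -/
theorem quadY_add (A B : Matrix (Fin 3) (Fin 3) ℝ) (y : E3) : quadY (A + B) y = quadY A y + quadY B y := by
  simp only [quadY, Matrix.add_apply, mul_add, add_mul, Finset.sum_add_distrib]

/-- `Y_0 = 0`. -/
theorem quadY_zero (y : E3) : quadY 0 y = 0 := by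
  simp [quadY]

/-- `Q ↦ Y_Q(y)` commutes with finite sums. -/
theorem quadY_finset_sum {ι : Type*} (s : Finset ι) (f : ι → Matrix (Fin 3) (Fin 3) ℝ) (y : E3) :
    quadY (∑ m ∈ s, f m) y = ∑ m ∈ s, quadY (f m) y := by
  classical
  induction s using Finset.induction_on with
  | empty => simp [quadY_zero]
  | insert a s ha ih => rw [Finset.sum_insert ha, Finset.sum_insert ha, quadY_add, ih]

/-- `Y_Q = Σₘ coordₘ(Q) · Y_{Eₘ}` for a trace-free symmetric form. -/
theorem quadY_eq_sum_coord {M : Matrix (Fin 3) (Fin 3) ℝ} (hM : IsQuadForm M) (y : E3) :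
    quadY M y = ∑ m : Fin 5, coordV2 M m * quadY (basisV2 m) y := by
  conv_lhs => rw [eq_sum_coordV2 hM]
  rw [quadY_finset_sum]
  simp only [quadY_smul]

/-- the five basis quadratics evaluated: `Σₘ gₘ Y_{Eₘ}(y) = g₀(y₀²−y₂²) + g₁(y₁²−y₂²) + 2g₂y₀y₁ + 2g₃y₀y₂ + 2g₄y₁y₂`. -/
theorem sum_mul_quadY_basisV2 (g : Fin 5 → ℝ) (y : E3) :
    ∑ m : Fin 5, g m * quadY (basisV2 m) y =
      g 0 * (y 0 ^ 2 - y 2 ^ 2) + g 1 * (y 1 ^ 2 - y 2 ^ 2) + g 2 * (2 * y 0 * y 1) + g 3 * (2 * y 0 * y 2) + g 4 * (2 * y 1 * y 2) := by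
  simp [Fin.sum_univ_five, Fin.sum_univ_three, quadY, basisV2]
  ring

/-- the five quadratics `Y_{Eₘ}` are linearly independent functions on `ℝ³`. -/
theorem linearIndependent_quadY_basisV2 : LinearIndependent ℝ (fun m : Fin 5 => quadY (basisV2 m)) := by
  rw [Fintype.linearIndependent_iff]
  intro g hg
  have hev : ∀ y : E3, ∑ m : Fin 5, g m * quadY (basisV2 m) y = 0 := fun y => by
    simpa [Finset.sum_apply, Pi.smul_apply, smul_eq_mul] using congr_fun hg y
  have h0 := hev (EuclideanSpace.single 0 1)
  have h1 := hev (EuclideanSpace.single 1 1)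
  have h01 := hev (EuclideanSpace.single 0 1 + EuclideanSpace.single 1 1)
  have h02 := hev (EuclideanSpace.single 0 1 + EuclideanSpace.single 2 1)
  have h12 := hev (EuclideanSpace.single 1 1 + EuclideanSpace.single 2 1)
  rw [sum_mul_quadY_basisV2] at h0 h1 h01 h02 h12
  simp at h0 h1 h01 h02 h12
  intro m
  fin_cases m <;> simp <;> linarith

/-! ## The isotypic degree-two dictionary -/

/-- `isoShell Q x₀` is the degree-two isotypic datum over the basis quadratics with the coordinate profiles of `Q`. -/
theorem isoShell_eq_isoShellL {Q : ℝ → Matrix (Fin 3) (Fin 3) ℝ} (hQ : ∀ r, 0 ≤ r → IsQuadForm (Q r)) (x₀ : E3) :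
    isoShell Q x₀ = isoShellL 5 (fun m r => coordV2 (Q r) m) (fun m => quadY (basisV2 m)) x₀ := by
  have hfun : (fun x : E3 => (quadY (Q ‖x - x₀‖) (x - x₀)) • (x - x₀)) =
      fun x : E3 => (∑ m : Fin 5, coordV2 (Q ‖x - x₀‖) m * quadY (basisV2 m) (x - x₀)) • (x - x₀) := by
    funext x
    rw [quadY_eq_sum_coord (hQ ‖x - x₀‖ (norm_nonneg _))]
  unfold isoShell isoShellL
  rw [hfun]

/-- the coordinate profiles of an admissible family are horn-admissible (they ARE entries). -/
theorem hornAdmissible_coord {Q : ℝ → Matrix (Fin 3) (Fin 3) ℝ} (hQ : IsoAdmissible Q) (m : Fin 5) :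
    HornAdmissible (fun r => coordV2 (Q r) m) := by
  obtain ⟨_, ⟨q, hq, hQq⟩, C, hC⟩ := hQ
  refine ⟨⟨fun s => q s (cI m) (cJ m), hq _ _, fun r hr => ?_⟩, C, fun r hr => hC r hr _ _⟩
  simp only [coordV2, hQq r hr]

/-- `IsoAdmissible Q ⇒` the coordinate data are an admissible degree-two isotypic family. -/
theorem isoAdmissibleL_coord {Q : ℝ → Matrix (Fin 3) (Fin 3) ℝ} (hQ : IsoAdmissible Q) :
    IsoAdmissibleL 2 5 (fun m r => coordV2 (Q r) m) (fun m => quadY (basisV2 m)) :=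
  ⟨fun m => isSolidHarmonic_quadY (isQuadForm_basisV2 m), fun m => virialAdmissible_two_of_hornAdmissible (hornAdmissible_coord hQ m)⟩

/-- entries of an admissible family are differentiable at every `r > 0` (they are `q(r²)` there). -/
theorem differentiableAt_entry {Q : ℝ → Matrix (Fin 3) (Fin 3) ℝ} (hQ : IsoAdmissible Q) {r : ℝ} (hr : 0 < r) (i j : Fin 3) :
    DifferentiableAt ℝ (fun s => Q s i j) r := by
  obtain ⟨_, ⟨q, hq, hQq⟩, _⟩ := hQ
  have hd : DifferentiableAt ℝ (fun s => q (s ^ 2) i j) r :=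
    (((hq i j).differentiable (by simp)).comp (differentiable_pow 2)).differentiableAt
  refine hd.congr_of_eventuallyEq ?_
  filter_upwards [Ioi_mem_nhds hr] with s hs
  simp only [hQq s hs.le]

/-- entries agree near `r > 0` with what symmetry / trace say: `Q₁₀ = Q₀₁`, … , `Q₂₂ = −Q₀₀ − Q₁₁` eventually. -/
theorem entry_eventuallyEq {Q : ℝ → Matrix (Fin 3) (Fin 3) ℝ} (hQ : IsoAdmissible Q) {r : ℝ} (hr : 0 < r) (i j : Fin 3) :
    (fun s => Q s i j) =ᶠ[𝓝 r] fun s => ∑ m : Fin 5, coordV2 (Q s) m * basisV2 m i j := by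
  filter_upwards [Ioi_mem_nhds hr] with s hs
  have h := eq_sum_coordV2 (hQ.1 s hs.le)
  have hij := congr_fun (congr_fun h i) j
  simpa [Matrix.sum_apply, Matrix.smul_apply] using hij

/-- for `r > 0` the entrywise radial derivative of an admissible family is the combination of the basis forms with the derivatives of the
coordinates (the derivative of a trace-free symmetric family is trace-free symmetric). -/
theorem radDeriv_eq_sum {Q : ℝ → Matrix (Fin 3) (Fin 3) ℝ} (hQ : IsoAdmissible Q) {r : ℝ} (hr : 0 < r) :
    radDeriv Q r = ∑ m : Fin 5, deriv (fun s => coordV2 (Q s) m) r • basisV2 m := by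
  ext i j
  simp only [radDeriv, Matrix.of_apply, Matrix.sum_apply, Matrix.smul_apply, smul_eq_mul]
  rw [(entry_eventuallyEq hQ hr i j).deriv_eq]
  have hdm : ∀ m : Fin 5, DifferentiableAt ℝ (fun s => coordV2 (Q s) m) r := fun m =>
    differentiableAt_entry hQ hr _ _
  rw [deriv_fun_sum fun m _ => (hdm m).mul_const _]
  refine Finset.sum_congr rfl fun m _ => ?_
  rw [deriv_mul_const (hdm m)]

/-- WEDGE FROM WRONSKIANS: if all radial Wronskians of the coordinate profiles of an admissible family vanish on `(0,∞)`, then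
`det[y, Q(r)y, Q′(r)y] = 0` for every `r > 0` (`Q′(r)` is proportional to `Q(r)`, or `Q(r) = 0`). -/
theorem wedgeVanishes_of_coord {Q : ℝ → Matrix (Fin 3) (Fin 3) ℝ} (hQ : IsoAdmissible Q)
    (hW : WedgeVanishesL 5 (fun m r => coordV2 (Q r) m)) : WedgeVanishes Q := by
  intro r hr y _hy
  have hQr : Q r = ∑ m : Fin 5, coordV2 (Q r) m • basisV2 m := eq_sum_coordV2 (hQ.1 r hr.le)
  have hDr := radDeriv_eq_sum hQ hr
  by_cases hzero : ∃ k : Fin 5, coordV2 (Q r) k ≠ 0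
  swap
  · have hz : ∀ m : Fin 5, coordV2 (Q r) m = 0 := fun m => not_not.mp fun h => hzero ⟨m, h⟩
    have hQ0 : Q r = 0 := by
      rw [hQr]
      exact Finset.sum_eq_zero fun m _ => by simp [hz m]
    rw [hQ0]
    exact wedgeDet_zero_left _ y
  · obtain ⟨k, hk⟩ := hzero
    set lam : ℝ := deriv (fun s => coordV2 (Q s) k) r / coordV2 (Q r) k with hlam
    have hprop : ∀ m : Fin 5, deriv (fun s => coordV2 (Q s) m) r = lam * coordV2 (Q r) m := by
      intro m
      have h := hW k m r hr
      rw [hlam]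
      field_simp
      linarith
    have hD : radDeriv Q r = lam • Q r := by
      rw [hDr, hQr, Finset.smul_sum]
      refine Finset.sum_congr rfl fun m _ => ?_
      rw [hprop m, smul_smul]
    rw [hD]
    simpa only [one_smul] using wedgeDet_smul_smul (Q r) 1 lam y

/-- ANALYTIC ENTRIES FROM ANALYTIC COORDINATES on `(0,∞)`. -/
theorem analyticOnNhd_entry_of_coord {Q : ℝ → Matrix (Fin 3) (Fin 3) ℝ} (hQ : IsoAdmissible Q)
    (hA : ∀ m : Fin 5, AnalyticOnNhd ℝ (fun r => coordV2 (Q r) m) (Set.Ioi 0)) (i j : Fin 3) :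
    AnalyticOnNhd ℝ (fun s => Q s i j) (Set.Ioi 0) := by
  have hsum : AnalyticOnNhd ℝ (fun s => ∑ m : Fin 5, coordV2 (Q s) m * basisV2 m i j) (Set.Ioi 0) :=
    Finset.analyticOnNhd_fun_sum _ fun m _ => (hA m).mul analyticOnNhd_const
  refine hsum.congr isOpen_Ioi fun s hs => ?_
  have h := eq_sum_coordV2 (hQ.1 s (le_of_lt hs))
  have hij := congr_fun (congr_fun h i) j
  simpa [Matrix.sum_apply, Matrix.smul_apply] using hij.symm

/-! ## The two by-name closures -/

/-- ★★ **BRIDGE W OF THE PRESSURE HORN LINE IS A THEOREM**: `PressureHorn.WindowWedgeAnalytic` — in an unthreaded bounded mild window all of whose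
slices are admissible `l = 2`-isotypic poloidal data `isoShell (Q_t) x₀`, every radial family `Q_t` has vanishing wedge `det[y, Q_t(r)y, Q_t′(r)y]`
and entries analytic on `(0,∞)`.  Proof: the isotypic degree-two dictionary feeds the window to `VirialHorn.windowWedgeAnalyticL_holds` (l = 2, the
five basis quadratics, coordinate profiles); its Wronskian/analyticity conclusions translate back by `wedgeVanishes_of_coord` /
`analyticOnNhd_entry_of_coord`.  A statement about HYPOTHETICAL isotypic windows (SPECIAL data); ⟨27585⟩, W2 and NS regularity remain OPEN. -/
theorem windowWedgeAnalytic_holds : WindowWedgeAnalytic := by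
  intro S hS u x₀ hcont hdiv hmild hbdd hunth Qf hslice t ht
  have hslice' : ∀ t ∈ S, IsoAdmissibleL 2 5 (fun m r => coordV2 (Qf t r) m) (fun m => quadY (basisV2 m)) ∧
      u t = isoShellL 5 (fun m r => coordV2 (Qf t r) m) (fun m => quadY (basisV2 m)) x₀ := fun t ht =>
    ⟨isoAdmissibleL_coord (hslice t ht).1, by rw [(hslice t ht).2]; exact isoShell_eq_isoShellL (hslice t ht).1.1 x₀⟩
  obtain ⟨hW, hA⟩ := windowWedgeAnalyticL_holds 2 5 S (by norm_num) hS u x₀ hcont hdiv hmild hbdd hunth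
    (fun m => quadY (basisV2 m)) (fun t m r => coordV2 (Qf t r) m) linearIndependent_quadY_basisV2 hslice' t ht
  exact ⟨wedgeVanishes_of_coord (hslice t ht).1 hW, analyticOnNhd_entry_of_coord (hslice t ht).1 hA⟩

/-- ★★ **THE ISOTYPIC `l = 2` WINDOW RUNG OF THE PRESSURE HORN LINE, UNCONDITIONALLY**: `PressureHorn.IsotypicWindowRigidity` — every unthreaded
window (hypotheses of `UnthreadedRigidity` VERBATIM) all of whose slices are admissible `l = 2`-isotypic poloidal data about `x₀` (a radial family of
trace-free symmetric forms depending on `t` arbitrarily) is axisymmetric about one common axis through `x₀`.  Proof: choose the family `Q_t` slicewise,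
pass to coordinates over the fixed basis quadratics (isotypic degree-two dictionary) and apply `ThreadingJets.isotypicWindowRigidity_all 2 5`.
(The same follows from `HornPressure.isotypicWindowRigidity_of_wedge windowWedgeAnalytic_holds`.)  SPECIAL data two levels below the door;
⟨27585⟩ / W2 / NS regularity OPEN — no summit statement is proved. -/
theorem isotypicWindowRigidity_holds : IsotypicWindowRigidity := by
  intro S hS hconn u x₀ hcont hdiv hmild hbdd hunth hiso
  choose! Qf hQf using hiso
  refine isotypicWindowRigidity_all 2 5 (by norm_num) S hS hconn u x₀ hcont hdiv hmild hbdd hunth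
    ⟨fun m => quadY (basisV2 m), fun t m r => coordV2 (Qf t r) m, linearIndependent_quadY_basisV2, fun t ht => ?_⟩
  exact ⟨isoAdmissibleL_coord (hQf t ht).1, by rw [(hQf t ht).2]; exact isoShell_eq_isoShellL (hQf t ht).1.1 x₀⟩

end Summit.NavierStokesRegularity.NavierStokesRegularity.Theorems.UnthreadedRigidity.HornPressure

end
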